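import Summits.NavierStokesRegularity.NavierStokesRegularity.Theses.TerminalTrace
import Literature.Analysis.FluidPDE.ClassicalSuitableRegionEnergy
import Literature.Analysis.FluidPDE.LocalTypeI
import Literature.Analysis.FluidPDE.LocalTypeIWeakSerrinProofs
import Literature.Analysis.FluidPDE.LerayHopfSpatialGradient
import Literature.Analysis.FluidPDE.Seregin2019LocalWeakL3Viscosity

/-!
# `TypeITraceScarL3` in the LOCALLY-weak-`L³` class — the fence is local (nsreg-p2 g30, ROUND-31)

Item `TerminalTrace.TypeITraceScarL3` (stmt-NavierStokesRegularity-18385) asks: at a singular point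
`x₀` of a Type-I (in time) blow-up at time `T`, the terminal profile `u(T)` is not in `L³` near `x₀`.

ROUND-29 (`typeITraceScarL3_of_weakL3Bounded`, this namespace) closed it in the GLOBAL class
`sup_{0<t<T} ‖u(t)‖_{L^{3,∞}(ℝ³)} < ∞` modulo the printed Choe–Wolf–Yang criterion.  The criterion is
in print in LOCALISED form — G. Seregin, *A note on weak solutions to the Navier–Stokes equations
that are locally in `L∞(L^{3,∞})`*, Algebra i Analiz 32:3 (2020) = St. Petersburg Math. J. 32:3
(2021), arXiv:1906.06707, **Proposition 1.4** (interior, scaled): for a suitable weak solution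
`(v,q)` in one backward cylinder `Q(z₀,R)` with `‖v‖_{L∞(t₀−R²,t₀; L^{3,∞}(B(x₀,R)))} ≤ M` and
`D₀(q,R;z₀) + E(v,R;z₀) ≤ N` (`E = R⁻¹∫∫_{Q(z₀,R)}|∇v|²`, `D₀ = R⁻²∫∫_{Q(z₀,R)}|q − [q]_{B(x₀,R)}|^{3/2}`,
the MEAN-FREE pressure oscillation) there is `ε = ε(M,N) ∈ (0,¼)` such that
`r⁻³|{x ∈ B(x₀,r) : |v(x,t₀)| > ε/r}| ≤ ε` for some `0 < r ≤ R/2` forces `v ∈ L∞(Q(z₀,εr))`.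

Hence the fence is LOCAL: if near `x₀` the solution is weak-`L³`-bounded on ONE backward cylinder
`(T−R², T) × B(x₀,R)` (any size `M`) and the pressure is in the printed class `L^{3/2}(Q_R)`
(automatic for the physical pressure; the scaled dissipation and the mean-free pressure oscillation
at that scale are then finite — proved below), an `L³` terminal trace near `x₀`
gives the density condition at every small scale (Chebyshev + absolute continuity) and `(T,x₀)`
would be regular.  So the open core of the item is LOUD AT `x₀` ITSELF:
`sup_{T−R²<t<T} ‖u(t)‖_{L^{3,∞}(B(x₀,R))} = ∞` for every `R > 0`.

This file records the implication with Seregin's Proposition 1.4 taken BY NAME as the Literature fact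
`Literature.Analysis.FluidPDE.seregin2019_localWeakL3_epsRegularity` (file
`Literature/Analysis/FluidPDE/Seregin2019LocalWeakL3.lean`, nsreg-typer g22, p608230; printed at `ν = 1` over
the class `IsSuitableWeakSolutionInBall`), used through its proved ν-form
`seregin2019_localWeakL3_epsRegularity.of_suitableWeakOn_viscosity` (file
`Literature/Analysis/FluidPDE/Seregin2019LocalWeakL3Viscosity.lean`, p609917): that fact with the InBall
class unpacked at viscosity `ν` (`IsSuitableWeakSolutionOn` on the open cylinder + `esssup_t ∫_{B_R}|v|² < ∞`
+ `q ∈ L^{3/2}(Q_R)`), the mean-free pressure quantity being Albritton–Barker's `cknDOsc` (= Seregin's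
`D₀`), the terminal slice `v t₀` tied to the solution by left weak-`L²` continuity against `L²` fields
supported in the ball (which identifies it a.e. with the printed «good representative», p. 3 of the
note); the ν-form follows from the fact by the Navier–Stokes rescaling `v(y,s) = ν⁻¹u(y,s/ν)` at the
scale `R·min(1,√ν)` (v1.5).  The suitability of the
item's classical solution on the cylinder, the `L∞L²` bound (Leray–Hopf energy bound), the
square-integrable weak spatial gradient on the cylinder (v1.4: the Leray–Hopf gradient of
`IsLerayHopfOn.exists_hasWeakSpatialGradientOn` restricted from the strip `(0,T) × ℝ³` — so
`cknE < ∞` is proved), the finiteness of the mean-free pressure oscillation (v1.3: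
`cknDOsc ≤ 4·cknD < ∞` from `p ∈ L^{3/2}(Q_R)`, tree `AlbrittonBarker2019.cknDOsc_le_four_mul_cknD`)
and the weak continuity of its Leray–Hopf trace at `T` are PROVED here, not assumed; the class
hypothesis keeps only `p ∈ L^{3/2}(Q_R)` explicit (true for the physical pressure `p = R_iR_j(u_iu_j)`, NOT automatic for an
arbitrary classical pressure `p + c(t)` with `c` unbounded near `T`).
-/

set_option linter.dupNamespace false

open MeasureTheory Set Filter Topology Metric
open scoped ENNReal NNReal RealInnerProductSpace
open Literature.Analysis.FluidPDE

namespace Summit.NavierStokesRegularity.NavierStokesRegularity.Theorems.TypeITraceScarL3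

/-- **`TypeITraceScarL3` restricted to the locally-weak-`L³` class at `x₀`, modulo the printed
localised Choe–Wolf–Yang criterion taken by name** (the Literature fact
`seregin2019_localWeakL3_epsRegularity` = Seregin, arXiv:1906.06707, Prop. 1.4 at `ν = 1`; its ν-form is
the tree's `.of_suitableWeakOn_viscosity`).  The class hypothesis at `x₀` is: for some `M, R > 0` with
`R² ≤ T`, `h³·|{x ∈ B(x₀,R) : |u(t,x)| > h}| ≤ M³` for all `T − R² < t < T`, `h > 0` (local weak-`L³`
bound, any size) and `p ∈ L^{3/2}(Q_R)` on the backward cylinder `Q_R = (T−R²,T) × B(x₀,R)` (the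
printed pressure class; the scaled dissipation `cknE` of the Leray–Hopf gradient and the mean-free
pressure oscillation `cknDOsc ≤ 4·cknD` at that scale are DERIVED in Step 0, v1.3/v1.4).  The item's
remaining binders are verbatim. [cite: Seregin2019, Prop. 1.4 (= arXiv:1906.06707 §1, Prop. 1.4)] -/
theorem typeITraceScarL3_of_localWeakL3Bounded :
    ∀ (ν T : ℝ), 0 < ν → 0 < T →
    -- the printed criterion BY NAME: Seregin 2019/2021, Proposition 1.4 (Literature fact, ν = 1;
    -- its ν-form `SerLocNu ν` is the tree's `.of_suitableWeakOn_viscosity`, p609917)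
    Literature.Analysis.FluidPDE.seregin2019_localWeakL3_epsRegularity →
    ∀ (u : ℝ → EuclideanSpace ℝ (Fin 3) → EuclideanSpace ℝ (Fin 3)) (p : ℝ → EuclideanSpace ℝ (Fin 3) → ℝ),
      IsClassicalNSSolutionOn (Set.Ico 0 T) ν 0 u p →
      IsLerayHopfOn T ν 0 (u 0) u →
      HasRapidSpatialDecay (u 0) →
      IsTypeIBlowup u T →
      ∀ x₀ : EuclideanSpace ℝ (Fin 3),
        -- the class: locally weak-L³ near `x₀` on one backward cylinder, any size `M`, plus the
        -- printed pressure class `p ∈ L^{3/2}(Q_R)` at that scale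
        (∃ M R : ℝ, 0 < R ∧ R ^ 2 ≤ T ∧
          (∀ t ∈ Ioo (T - R ^ 2) T, ∀ h : ℝ, 0 < h →
            ENNReal.ofReal (h ^ 3) *
                volume.restrict (ball x₀ R) {x : EuclideanSpace ℝ (Fin 3) | h < ‖u t x‖} ≤
              ENNReal.ofReal (M ^ 3)) ∧
          MemLp (Function.uncurry p) (3 / 2) (volume.restrict (parabolicCylinder R (T, x₀)))) →
        (∀ r : ℝ, 0 < r → eLpNorm (Function.uncurry u) ⊤
          (volume.restrict (parabolicCylinder r (T, x₀))) = ⊤) →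
        ∀ ρ : ℝ, 0 < ρ → ¬ MemLp (u T) 3 (volume.restrict (ball x₀ ρ)) := by
  intro ν T hν hT hF1 u p hcl hLH _hdec _hTI x₀ hclass hsing ρ hρ hL3
  have hSerLoc := hF1.of_suitableWeakOn_viscosity hν
  obtain ⟨M, R, hR, hRT, hWloc, hpL⟩ := hclass
  -- Step 0: the size `N` of the mean-free pressure oscillation + scaled dissipation at scale `R`;
  -- `D_osc(R) ≤ 4 D(R) < ∞` is automatic from `p ∈ L^{3/2}(Q_R)` (Albritton–Barker (1.6)).
  have hDfin : cknD R (T, x₀) p < ⊤ := by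
    rw [cknD]
    refine ENNReal.mul_lt_top
      (ENNReal.inv_lt_top.2 (ENNReal.pow_pos (ENNReal.ofReal_pos.2 hR) _)) ?_
    have h32 : ((3 : ℝ≥0∞) / 2).toReal = (3 / 2 : ℝ) := by
      rw [ENNReal.toReal_div]; norm_num
    have hI := lintegral_rpow_enorm_lt_top_of_eLpNorm_lt_top (by norm_num)
      (ENNReal.div_lt_top (by norm_num) (by norm_num)).ne hpL.2
    rw [h32] at hI
    simpa [Function.uncurry] using hI
  have hDOfin : cknDOsc R (T, x₀) p < ⊤ :=
    lt_of_le_of_lt (AlbrittonBarker2019.cknDOsc_le_four_mul_cknD hR hpL.1)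
      (ENNReal.mul_lt_top (by norm_num) hDfin)
  -- Step 0b: the Leray–Hopf weak spatial gradient `G` on the strip `(0,T) × ℝ³` (`u ∈ L²(0,T; Ḣ¹)`),
  -- restricted to the cylinder: `cknE R (T,x₀) G < ∞` is PROVED (v1.4), not assumed.
  obtain ⟨G, hGslab, -, hGint, -⟩ := hLH.exists_hasWeakSpatialGradientOn
  have hQslab : parabolicCylinder R (T, x₀) ⊆ Ioo 0 T ×ˢ (univ : Set (EuclideanSpace ℝ (Fin 3))) := by
    intro z hz
    rw [mem_parabolicCylinder] at hz
    refine mem_prod.2 ⟨⟨?_, hz.1.2⟩, mem_univ _⟩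
    have h1 : T - R ^ 2 < z.1 := hz.1.1
    linarith
  have hG : HasWeakSpatialGradientOn (parabolicCylinderOpens R (T, x₀)) u G :=
    hGslab.mono (fun z hz => mem_slab.2 (mem_prod.1 (hQslab hz)).1)
  have hfin : cknE R (T, x₀) G < ⊤ := by
    rw [cknE]
    refine ENNReal.mul_lt_top (ENNReal.inv_lt_top.2 (ENNReal.ofReal_pos.2 hR)) ?_
    exact lt_of_le_of_lt (lintegral_mono_set hQslab) hGint
  set S : ℝ≥0∞ := cknDOsc R (T, x₀) p + cknE R (T, x₀) G with hS_def
  have hSfin : S ≠ ⊤ := (ENNReal.add_lt_top.2 ⟨hDOfin, hfin⟩).ne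
  set N : ℝ := S.toReal + 1 with hN_def
  have hN : 0 < N := by rw [hN_def]; positivity
  have hSN : S ≤ ENNReal.ofReal N := by
    rw [hN_def]
    calc S = ENNReal.ofReal S.toReal := (ENNReal.ofReal_toReal hSfin).symm
      _ ≤ ENNReal.ofReal (S.toReal + 1) := ENNReal.ofReal_le_ofReal (by linarith)
  obtain ⟨ε, hε, hcrit⟩ := hSerLoc M N
  -- Step 1: the item's classical solution is a suitable weak solution on the backward cylinder
  have hsub : parabolicCylinder R (T, x₀) ⊆ Set.Ico 0 T ×ˢ (univ : Set (EuclideanSpace ℝ (Fin 3))) := by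
    intro z hz
    rw [mem_parabolicCylinder] at hz
    refine mem_prod.2 ⟨⟨?_, ?_⟩, mem_univ _⟩
    · have h1 : T - R ^ 2 < z.1 := hz.1.1
      linarith
    · exact hz.1.2
  have hreg : IsClassicalNSSolutionOnRegion (parabolicCylinder R (T, x₀)) ν 0 u p :=
    hcl.onRegion.mono_of_isOpen hsub (isOpen_parabolicCylinder R (T, x₀))
  have hsw : IsSuitableWeakSolutionOn (parabolicCylinderOpens R (T, x₀)) ν 0 u p :=
    hreg.isSuitableWeakSolutionOn (isOpen_parabolicCylinder R (T, x₀)) hν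
  -- Step 1b: `u ∈ L∞(T−R², T; L²(B(x₀,R)))` from the Leray–Hopf energy bound
  have hL2 : ∃ C : ℝ≥0, ∀ᵐ t ∂(volume.restrict (Ioo (T - R ^ 2) T)),
      ∫⁻ x in ball x₀ R, ‖u t x‖ₑ ^ 2 ≤ C := by
    obtain ⟨C, hC⟩ := hLH.energy_bound
    refine ⟨C, ?_⟩
    have hsubI : Ioo (T - R ^ 2) T ⊆ Ioo 0 T :=
      Ioo_subset_Ioo (by nlinarith [sq_nonneg R]) le_rfl
    filter_upwards [ae_restrict_of_ae_restrict_of_subset hsubI hC] with t ht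
    exact (setLIntegral_le_lintegral _ _).trans (by simpa [eEnergy] using ht)
  -- Step 2: the Leray–Hopf terminal slice `u T` is the left weak-`L²` limit
  have hwc : ∀ w : EuclideanSpace ℝ (Fin 3) → EuclideanSpace ℝ (Fin 3), MemLp w 2 volume →
      Tendsto (fun t => ∫ x, ⟪u t x, w x⟫) (𝓝[<] T) (𝓝 (∫ x, ⟪u T x, w x⟫)) := by
    intro w hw
    have hc : ContinuousWithinAt (fun t => ∫ x, ⟪u t x, w x⟫) (Ioc 0 T) T :=
      (hLH.weak_continuous w hw).1 T ⟨hT, le_rfl⟩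
    have hc' : ContinuousWithinAt (fun t => ∫ x, ⟪u t x, w x⟫) (Ioo 0 T) T :=
      hc.mono Ioo_subset_Ioc_self
    rwa [continuousWithinAt_Ioo_iff_Iio hT] at hc'
  -- Step 3: `∫_{B(x₀,ρ)} |u(T)|³ < ∞` as a lower Lebesgue integral
  set μ : Measure (EuclideanSpace ℝ (Fin 3)) := volume.restrict (ball x₀ ρ) with hμ_def
  set F : EuclideanSpace ℝ (Fin 3) → ℝ≥0∞ := fun x => ‖u T x‖ₑ ^ (3 : ℝ) with hF_def
  have hFmeas : AEMeasurable F μ :=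
    (hL3.aestronglyMeasurable.enorm.pow_const (3 : ℝ))
  have hFint : ∫⁻ x, F x ∂μ ≠ ⊤ := by
    have h := lintegral_rpow_enorm_lt_top_of_eLpNorm_lt_top (by norm_num : (3 : ℝ≥0∞) ≠ 0)
      (by norm_num : (3 : ℝ≥0∞) ≠ ⊤) hL3.eLpNorm_lt_top
    have h3 : ENNReal.toReal 3 = (3 : ℝ) := by norm_num
    rw [h3] at h
    exact h.ne
  -- Step 4: absolute continuity: small balls carry `L³`-mass `< ε⁴`
  have hε4 : ENNReal.ofReal (ε ^ 4) ≠ 0 := by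
    rw [ne_eq, ENNReal.ofReal_eq_zero, not_le]; positivity
  obtain ⟨δ, hδ, hsmall⟩ := exists_pos_setLIntegral_lt_of_measure_lt hFint hε4
  have hvol : Tendsto (fun r : ℝ => volume (ball x₀ r)) (𝓝[>] 0) (𝓝 0) := by
    set c : ℝ := (volume (ball (0 : EuclideanSpace ℝ (Fin 3)) 1)).toReal with hc_def
    have h0 : Tendsto (fun r : ℝ => ENNReal.ofReal (r ^ 3 * c)) (𝓝 0)
        (𝓝 (ENNReal.ofReal ((0 : ℝ) ^ 3 * c))) :=
      (ENNReal.continuous_ofReal.tendsto _).comp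
        (((continuous_pow 3).mul continuous_const).tendsto 0)
    rw [show ((0 : ℝ) ^ 3 * c) = 0 by ring, ENNReal.ofReal_zero] at h0
    refine (tendsto_nhdsWithin_of_tendsto_nhds h0).congr' ?_
    filter_upwards [self_mem_nhdsWithin] with r hr
    have hr' : (0 : ℝ) ≤ r := le_of_lt hr
    rw [hc_def, Measure.addHaar_ball volume x₀ hr', finrank_euclideanSpace_fin,
      ENNReal.ofReal_mul (pow_nonneg hr' 3), ENNReal.ofReal_toReal measure_ball_lt_top.ne]
  have hev1 : ∀ᶠ r : ℝ in 𝓝[>] 0, volume (ball x₀ r) < δ := hvol (gt_mem_nhds hδ)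
  have hev2 : ∀ᶠ r : ℝ in 𝓝[>] 0, r < ρ :=
    eventually_nhdsWithin_of_eventually_nhds (eventually_lt_nhds hρ)
  have hev4 : ∀ᶠ r : ℝ in 𝓝[>] 0, r ∈ Ioi (0 : ℝ) := eventually_mem_nhdsWithin
  have hev5 : ∀ᶠ r : ℝ in 𝓝[>] 0, r ≤ R / 2 :=
    eventually_nhdsWithin_of_eventually_nhds (eventually_le_nhds (by positivity : (0 : ℝ) < R / 2))
  -- Step 5: the density condition at EVERY small scale `r` by Chebyshev
  have hdens : ∀ᶠ r : ℝ in 𝓝[>] 0,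
      volume.restrict (ball x₀ r) {x : EuclideanSpace ℝ (Fin 3) | ε / r < ‖u T x‖} ≤
        ENNReal.ofReal (ε * r ^ 3) := by
    filter_upwards [hev1, hev2, hev4] with r hr1 hr2 hr4
    have hr : 0 < r := hr4
    have hsub : ball x₀ r ⊆ ball x₀ ρ := ball_subset_ball hr2.le
    have hmass : ∫⁻ x in ball x₀ r, F x ∂volume < ENNReal.ofReal (ε ^ 4) := by
      have h1 : ∫⁻ x in ball x₀ r, F x ∂μ < ENNReal.ofReal (ε ^ 4) := by
        refine hsmall _ ?_
        rw [hμ_def, Measure.restrict_apply measurableSet_ball,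
          inter_eq_left.mpr hsub]
        exact hr1
      rwa [hμ_def, Measure.restrict_restrict measurableSet_ball, inter_eq_left.mpr hsub] at h1
    set lev : ℝ≥0∞ := ENNReal.ofReal ((ε / r) ^ 3) with hlev_def
    have hlev0 : lev ≠ 0 := by
      rw [hlev_def, ne_eq, ENNReal.ofReal_eq_zero, not_le]; positivity
    have hlevtop : lev ≠ ⊤ := ENNReal.ofReal_ne_top
    have hmono : {x : EuclideanSpace ℝ (Fin 3) | ε / r < ‖u T x‖} ⊆
        {x : EuclideanSpace ℝ (Fin 3) | lev ≤ F x} := by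
      intro x hx
      simp only [mem_setOf_eq] at hx ⊢
      rw [hF_def, hlev_def]
      dsimp only
      rw [← ofReal_norm, ENNReal.ofReal_rpow_of_nonneg (norm_nonneg _) (by norm_num)]
      refine ENNReal.ofReal_le_ofReal ?_
      have hεr : 0 ≤ ε / r := by positivity
      calc (ε / r) ^ 3 ≤ ‖u T x‖ ^ 3 := by
            exact pow_le_pow_left₀ hεr hx.le 3
        _ = ‖u T x‖ ^ (3 : ℝ) := by norm_cast
    have hFmeas' : AEMeasurable F (volume.restrict (ball x₀ r)) := by
      have : volume.restrict (ball x₀ r) = μ.restrict (ball x₀ r) := by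
        rw [hμ_def, Measure.restrict_restrict measurableSet_ball, inter_eq_left.mpr hsub]
      rw [this]
      exact hFmeas.restrict
    have hcheb := mul_meas_ge_le_lintegral₀ hFmeas' lev
    have hm : volume.restrict (ball x₀ r) {x : EuclideanSpace ℝ (Fin 3) | lev ≤ F x} ≤
        ENNReal.ofReal (ε ^ 4) / lev := by
      rw [ENNReal.le_div_iff_mul_le (Or.inl hlev0) (Or.inl hlevtop), mul_comm]
      exact hcheb.trans hmass.le
    have hq : ENNReal.ofReal (ε ^ 4) / lev = ENNReal.ofReal (ε * r ^ 3) := by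
      rw [hlev_def, ← ENNReal.ofReal_div_of_pos (by positivity)]
      congr 1
      field_simp
    calc volume.restrict (ball x₀ r) {x : EuclideanSpace ℝ (Fin 3) | ε / r < ‖u T x‖}
        ≤ volume.restrict (ball x₀ r) {x : EuclideanSpace ℝ (Fin 3) | lev ≤ F x} :=
          measure_mono hmono
      _ ≤ ENNReal.ofReal (ε ^ 4) / lev := hm
      _ = ENNReal.ofReal (ε * r ^ 3) := hq
  -- Step 6: at one small scale `r ≤ R/2` the criterion gives boundedness on `Q((T,x₀), εr)`,
  -- contradicting the singular point
  obtain ⟨r, hr4, hr5, hdr⟩ := (hev4.and (hev5.and hdens)).exists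
  have hr : 0 < r := hr4
  have hbd := hcrit (T, x₀) R hR u p hsw hL2 hpL G hG hSN hWloc
    (fun w hw _ => hwc w hw) r hr hr5 hdr
  exact absurd (hsing (ε * r) (by positivity)) hbd.ne

/-- **`TypeITraceScarL3` for blow-ups that are Type I in SPACE–TIME at `x₀`** (corollary of
`typeITraceScarL3_of_localWeakL3Bounded`): the scale-invariant envelope
`|x − x₀|·|u(t,x)| ≤ C'` on one backward cylinder `(T−R²,T) × B(x₀,R)` puts every slice in
weak-`L³(B(x₀,R))` with `h³·|{|u(t)| > h} ∩ B(x₀,R)| ≤ 8C'³|B₁|` (the super-level set lies in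
`B(x₀, 2C'/h)`), so the local fence applies.  The envelope is written as a product (no division by
`|x − x₀|`).  Same Literature fact and the same pressure clause as above; consequence
for the item: its open core is Type I in time but NOT Type I in space at `x₀`
(`sup |x − x₀|·|u(t,x)| = ∞` near `(T,x₀)`). [cite: Seregin2019, Prop. 1.4 (= arXiv:1906.06707 §1, Prop. 1.4)] -/
theorem typeITraceScarL3_of_spaceTimeTypeI :
    ∀ (ν T : ℝ), 0 < ν → 0 < T →
    Literature.Analysis.FluidPDE.seregin2019_localWeakL3_epsRegularity →
    ∀ (u : ℝ → EuclideanSpace ℝ (Fin 3) → EuclideanSpace ℝ (Fin 3)) (p : ℝ → EuclideanSpace ℝ (Fin 3) → ℝ),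
      IsClassicalNSSolutionOn (Set.Ico 0 T) ν 0 u p →
      IsLerayHopfOn T ν 0 (u 0) u →
      HasRapidSpatialDecay (u 0) →
      IsTypeIBlowup u T →
      ∀ x₀ : EuclideanSpace ℝ (Fin 3),
        -- the class: Type I in space on one backward cylinder at `x₀` (product form), plus the
        -- pressure clause of the local fence
        (∃ C' R : ℝ, 0 < C' ∧ 0 < R ∧ R ^ 2 ≤ T ∧
          (∀ t ∈ Ioo (T - R ^ 2) T, ∀ x ∈ ball x₀ R, ‖x - x₀‖ * ‖u t x‖ ≤ C') ∧
          MemLp (Function.uncurry p) (3 / 2) (volume.restrict (parabolicCylinder R (T, x₀)))) →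
        (∀ r : ℝ, 0 < r → eLpNorm (Function.uncurry u) ⊤
          (volume.restrict (parabolicCylinder r (T, x₀))) = ⊤) →
        ∀ ρ : ℝ, 0 < ρ → ¬ MemLp (u T) 3 (volume.restrict (ball x₀ ρ)) := by
  intro ν T hν hT hF1 u p hcl hLH hdec hTI x₀ hclass hsing ρ hρ
  obtain ⟨C', R, hC', hR, hRT, henv, hpL⟩ := hclass
  -- the weak-L³ constant: `M := 2 C' (c₁ + 1)` with `c₁ = |B₁|`, so that `8 C'³ c₁ ≤ M³`
  set c₁ : ℝ := (volume (ball (0 : EuclideanSpace ℝ (Fin 3)) 1)).toReal with hc₁_def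
  have hc₁ : 0 ≤ c₁ := ENNReal.toReal_nonneg
  set M : ℝ := 2 * C' * (c₁ + 1) with hM_def
  have hM : 0 < M := by rw [hM_def]; positivity
  refine typeITraceScarL3_of_localWeakL3Bounded ν T hν hT hF1 u p hcl hLH hdec hTI x₀
    ⟨M, R, hR, hRT, ?_, hpL⟩ hsing ρ hρ
  intro t ht h hh
  -- the super-level set inside `B(x₀,R)` lies in `B(x₀, 2C'/h)`
  have hsub : {x : EuclideanSpace ℝ (Fin 3) | h < ‖u t x‖} ∩ ball x₀ R ⊆ ball x₀ (2 * C' / h) := by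
    rintro x ⟨hx, hxR⟩
    simp only [mem_setOf_eq] at hx
    rw [mem_ball, dist_eq_norm]
    have h1 : ‖x - x₀‖ * ‖u t x‖ ≤ C' := henv t ht x hxR
    have h2 : ‖x - x₀‖ * h ≤ C' := by
      refine le_trans ?_ h1
      exact mul_le_mul_of_nonneg_left hx.le (norm_nonneg _)
    have h3 : ‖x - x₀‖ ≤ C' / h := by
      rw [le_div_iff₀ hh]; exact h2
    have h4 : C' / h < 2 * C' / h := by
      rw [div_lt_div_iff_of_pos_right hh]; linarith
    exact lt_of_le_of_lt h3 h4
  have hmeas : volume.restrict (ball x₀ R) {x : EuclideanSpace ℝ (Fin 3) | h < ‖u t x‖} ≤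
      volume (ball x₀ (2 * C' / h)) := by
    rw [Measure.restrict_apply' measurableSet_ball]
    exact measure_mono hsub
  have hr0 : (0 : ℝ) ≤ 2 * C' / h := by positivity
  have hvol : volume (ball x₀ (2 * C' / h)) = ENNReal.ofReal ((2 * C' / h) ^ 3 * c₁) := by
    rw [Measure.addHaar_ball volume x₀ hr0, finrank_euclideanSpace_fin,
      ENNReal.ofReal_mul (pow_nonneg hr0 3), hc₁_def, ENNReal.ofReal_toReal measure_ball_lt_top.ne,
      ENNReal.ofReal_pow hr0]
  calc ENNReal.ofReal (h ^ 3) * volume.restrict (ball x₀ R) {x : EuclideanSpace ℝ (Fin 3) | h < ‖u t x‖}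
      ≤ ENNReal.ofReal (h ^ 3) * ENNReal.ofReal ((2 * C' / h) ^ 3 * c₁) := by
        rw [← hvol]; gcongr
    _ = ENNReal.ofReal (8 * C' ^ 3 * c₁) := by
        rw [← ENNReal.ofReal_mul (pow_nonneg hh.le 3)]
        congr 1
        field_simp
        ring
    _ ≤ ENNReal.ofReal (M ^ 3) := by
        refine ENNReal.ofReal_le_ofReal ?_
        rw [hM_def]
        have h8 : (2 * C' * (c₁ + 1)) ^ 3 = 8 * C' ^ 3 * (c₁ + 1) ^ 3 := by ring
        rw [h8]
        have hc3 : c₁ ≤ (c₁ + 1) ^ 3 := by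
          nlinarith [mul_nonneg (mul_nonneg hc₁ hc₁) hc₁, mul_nonneg hc₁ hc₁]
        have hC3 : 0 ≤ 8 * C' ^ 3 := by positivity
        exact mul_le_mul_of_nonneg_left hc3 hC3

end Summit.NavierStokesRegularity.NavierStokesRegularity.Theorems.TypeITraceScarL3
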